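import Summits.QuantumFields.YangMills.Theorems.UnitScaleTiltHalvingCompetitorMapFrames
import Summits.QuantumFields.YangMills.Theorems.UnitScaleTiltProp8ChartDoubleBarDiffBall
import Summits.QuantumFields.YangMills.Theorems.UnitScaleTiltProp8ChartDoubleBarBall
import HarnessLib

/-!
# Route `UnitScaleTilt`, crux K1 child «MinimiserStabilityRegPr» (stmt-QuantumFields-19200), registered stub `stub_halvingStep` (H), door v3 (Stat currency),
# row B5 «DIFFERENTIABLE GAUGE FIX» (LEAD ★w5-19200 g4 RULING L-7 (a)), file A of three — **THE ACCUMULATED-FRAME QUOTIENT OF ✓`HalvingCompetitorMapFrames`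
# IS DIFFERENTIABLE IN A PARAMETER**: for a family of fields `x ↦ W_x` that is bondwise ℂ-differentiable at `x₀`, INDEX-PINNED to a fixed field `W′` for all `x`
# near `x₀`, and near-flat at `x₀` under the `Ω`-blocks, the coarse re-gauge `x ↦ V_j(W_x)(y)·V_j(W′)(y)⁻¹` of B1 is ℂ-differentiable at `x₀` at EVERY site —
# only the `Ω`-block frames are ever differentiated (there the fields are small and the frames are analytic `eml`'s); off `Ω` the two block frames COINCIDE
# (✓`vframeU_dbarIterU_eq_of_not_mem_Om`), so the quotient is locally CONSTANT in the parameter there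

Cell `ym3-torus` (HUMAN RULING D-0037, YM ladder rung R3 — continuum SU(2) YM₃ on the torus is a RUNG, not the Clay problem), width seat `ym-ust-19200-w1` gen 8.
`--supports stmt-QuantumFields-19200 --as helper`; def-free, 0 sorry, standard axioms; counts toward nothing by itself.

WHY (L-7 (a), B5).  Door v3 replaces minimality by STATIONARITY along bondwise-differentiable exact-fibre curves; the L4-Stat writer turns the competitor line
`t ↦ Φloc (A + t•Y)` into an exact-fibre curve `t ↦ h_t • Φloc (A + t•Y)` with the `SU(2)` gauge `h_t` of ✓B3∕B4 (`exists_gaugeAct_mem_fibre(_of_chart49)`), and needs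
`t ↦ ↑(h_t z)` differentiable.  That gauge is the fine lift of the inverse of B1's coarse gauge `g y = V_k(W) y · V_k(W′) y⁻¹ · (uS)_k y`
(✓`emlIterU_top_eq_gaugeActT_frames`), so everything reduces to the differentiability of the frame quotient proved here; files B∕C of the row assemble.

WHAT IS PROVED (ns `…Theorems.HalvingCompetitorMapFramesSmooth`; any `P`, complete normed `ℂ`-algebra `𝔸` with `‖1‖ = 1`, ℂ-normed parameter space `E`).
* §1 ★ `differentiableAt_coe_dbarIterU_family` — the general-family twin of ✓`differentiableAt_coe_dbarIterU_of_reads` (which is `expCfg`-specific): `x ↦ U̿^{(i)}(W_x)(e)`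
  is ℂ-differentiable at `x₀` when the bond variables of `W_x` on the read territory `S ∋ e₋, e₊` are differentiable at `x₀` and within `s₀` of `1` at `x₀`,
  `8·3800·ℓ²·Lⁱ·s₀ ≤ 1` (induction on `i` over ✓`differentiableAt_coe_dbarAvgU_of_twoBlock`, near-flatness from ✓`norm_dbarIterU_sub_one_le_two_mul₀`).
* §2 ★ `differentiableAt_coe_vframeU_dbarIterU_family` — the block frame `x ↦ v(U̿^{(j)}(W_x))(z)` of a `(j+1)`-block `z` is ℂ-differentiable at `x₀` when the fine
  bond variables under `z` are differentiable at `x₀` and within `s` of `1` at `x₀`, `8·3800·ℓ²·L^{j+1}·s ≤ 1` (B3's `hWs`∕`hbudget` letters).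
* §3 ★★ `differentiableAt_coe_accFrames_quotient` — for ANY accumulated-frames function `Vf` obeying (97) (`Vf W 0 = 1`, `Vf W (j+1) y = Vf W j (emb y)·v(U̿^{(j)}W)(y)`),
  a nested family `D`, a fixed field `W′`, a family `W_x` bondwise differentiable at `x₀`, index-pinned to `W′` EVENTUALLY near `x₀`, near-flat at `x₀` under the
  `Ω_{j+1}`-blocks with the B2 budgets: at every level `j ≤ k`, (a) `x ↦ Vf W_x j y` is differentiable at `x₀` for `y ∈ Ω_j`, (b) `x ↦ Vf W_x j y · (Vf W′ j y)⁻¹` is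
  differentiable at `x₀` for EVERY `y` (B1 §3's dichotomy run on functions; off `Ω` by ✓`vframeU_dbarIterU_eq_of_not_mem_Om` + `Filter.EventuallyEq`);
  ★ `differentiableAt_coe_gauge_frames` — hence so is B1's coarse gauge `x ↦ Vf W_x k y · (Vf W′ k y)⁻¹ · c y` for any parameter-free `c`.
HONEST SCOPE: first-order calculus over landed lemmas; nothing of print is asserted; NOT a claim about the stub, the crux, the rung or a mass gap.

References: T. Bałaban, CMP **98** (1985) 17–51 [Balaban1985Averaging] ((89) p.31, (92) p.31, (97)–(100) p.32, (110) p.34, Prop. 4 (134)–(135) p.38); CMP **102** (1985)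
277–309 [Balaban1985Variational] ((6) p.278, (150) p.301, (156) p.302); CMP **96** (1984) 223–250 [Balaban1984PropagatorsII] ((2.1)–(2.4) p.224).
-/

set_option autoImplicit false

noncomputable section

open scoped Topology
open Filter

namespace Summit.QuantumFields.YangMills.Theorems.HalvingCompetitorMapFramesSmooth

open Literature.MathematicalPhysics.QuantumFieldTheory.Balaban1983to89
open T4Continuum BlockAveraging ExpMeanLog
open B10Eq27TorusAxialLog (holT)
open B5Eq118OneStroke (iterBlockOf iterBlockOf_succ iterBlockOf_zero)
open B6SectADomainsV1 (Domains)
open B6SectAOperatorsV1 (BondIdx)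
open Summit.QuantumFields.YangMills.Theorems.Prop8Chart (differentiableAt_coe_inv)
open Summit.QuantumFields.YangMills.Theorems.Prop8ChartDoubleBar (vframeU dbarAvgU dbarIterU dbarIterU_zero dbarIterU_succ differentiableAt_coe_vframeU_of_block
  differentiableAt_coe_dbarAvgU_of_twoBlock norm_stairHol_sub_one_lt_one norm_dbarIterU_sub_one_le_two_mul₀)
open Summit.QuantumFields.YangMills.Theorems.HalvingCompetitorMapFrames (vframeU_dbarIterU_eq_of_not_mem_Om)

variable {P : Params} {𝔸 : Type*} [NormedRing 𝔸] [NormedAlgebra ℂ 𝔸] [CompleteSpace 𝔸]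
variable {E : Type*} [NormedAddCommGroup E] [NormedSpace ℂ E]

/-! ## §1 The iterated double-bar average of a differentiable family -/

/-- ★ **`x ↦ U̿^{(i)}(W_x)(e)` IS ℂ-DIFFERENTIABLE AT `x₀`** when, on the read territory under `S ∋ e₋, e₊`, the bond variables of the family are differentiable at `x₀` and
those of `W_{x₀}` are within `s₀` of `1`, `8·3800·ℓ²·Lⁱ·s₀ ≤ 1` — the general-family twin of ✓`differentiableAt_coe_dbarIterU_of_reads`.
[cite: Balaban1985Averaging, (89) p.31, Prop. 4 (134)-(135) p.38; Balaban1985Variational, (156) p.302] -/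
theorem differentiableAt_coe_dbarIterU_family [NormOneClass 𝔸] (F : E → GaugeField P 0 𝔸ˣ) (x₀ : E) :
    ∀ (i : ℕ), i ≤ P.m + P.K → ∀ (S : Set (Site P i)) (s₀ : ℝ), 0 ≤ s₀ →
      8 * 3800 * (((P.d + 2) * P.L : ℕ) : ℝ) ^ 2 * (P.L : ℝ) ^ i * s₀ ≤ 1 →
      (∀ b : PBond P 0, iterBlockOf i b.src ∈ S → iterBlockOf i b.tgt ∈ S → ‖((F x₀ b : 𝔸ˣ) : 𝔸) - 1‖ ≤ s₀) →
      (∀ b : PBond P 0, iterBlockOf i b.src ∈ S → iterBlockOf i b.tgt ∈ S → DifferentiableAt ℂ (fun x => ((F x b : 𝔸ˣ) : 𝔸)) x₀) →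
      ∀ e : PBond P i, e.src ∈ S → e.tgt ∈ S →
        DifferentiableAt ℂ (fun x => ((dbarIterU i (F x) e : 𝔸ˣ) : 𝔸)) x₀ := by
  set ℓ : ℝ := (((P.d + 2) * P.L : ℕ) : ℝ) with hℓ
  have hℓ1 : (1 : ℝ) ≤ ℓ := by
    rw [hℓ]; exact_mod_cast Nat.one_le_iff_ne_zero.mpr (Nat.mul_ne_zero (by omega) (by have := P.hL.2; omega))
  have hL1 : (1 : ℝ) ≤ P.L := by exact_mod_cast P.L_pos
  intro i
  induction i with
  | zero =>
    intro _ S s₀ _ _ _ hdiff e hs ht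
    simpa only [dbarIterU_zero] using hdiff e (by simpa only [iterBlockOf_zero] using hs) (by simpa only [iterBlockOf_zero] using ht)
  | succ i ih =>
    intro hi S s₀ hs₀ hbudget hflat hdiff c hcs hct
    have hbudget_i : 8 * 3800 * ℓ ^ 2 * (P.L : ℝ) ^ i * s₀ ≤ 1 := by
      refine le_trans ?_ hbudget
      have : (P.L : ℝ) ^ i ≤ (P.L : ℝ) ^ (i + 1) := pow_le_pow_right₀ hL1 (Nat.le_succ i)
      have h0 : 0 ≤ 8 * 3800 * ℓ ^ 2 * s₀ := by positivity
      nlinarith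
    set S' : Set (Site P i) := {y | blockOf y ∈ S} with hS'
    have hflat' : ∀ b : PBond P 0, iterBlockOf i b.src ∈ S' → iterBlockOf i b.tgt ∈ S' → ‖((F x₀ b : 𝔸ˣ) : 𝔸) - 1‖ ≤ s₀ :=
      fun b hs ht => hflat b (by rw [iterBlockOf_succ]; exact hs) (by rw [iterBlockOf_succ]; exact ht)
    have hdiff' : ∀ b : PBond P 0, iterBlockOf i b.src ∈ S' → iterBlockOf i b.tgt ∈ S' → DifferentiableAt ℂ (fun x => ((F x b : 𝔸ˣ) : 𝔸)) x₀ :=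
      fun b hs ht => hdiff b (by rw [iterBlockOf_succ]; exact hs) (by rw [iterBlockOf_succ]; exact ht)
    have hF : ∀ e : PBond P i, e.src ∈ S' → e.tgt ∈ S' → DifferentiableAt ℂ (fun x => ((dbarIterU i (F x) e : 𝔸ˣ) : 𝔸)) x₀ :=
      ih (Nat.le_of_succ_le hi) S' s₀ hs₀ hbudget_i hflat' hdiff'
    -- near-flatness of the level-`i` double-bar field of `W_{x₀}` under `S`
    have hnear : ∀ e : PBond P i, e.src ∈ S' → e.tgt ∈ S' → ‖((dbarIterU i (F x₀) e : 𝔸ˣ) : 𝔸) - 1‖ ≤ 2 * ((P.L : ℝ) ^ i * s₀) :=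
      fun e hs ht => norm_dbarIterU_sub_one_le_two_mul₀ (Nat.le_of_succ_le hi) S' (F x₀) hs₀ hbudget_i hflat' e hs ht
    have hfun : (fun x => ((dbarIterU (i + 1) (F x) c : 𝔸ˣ) : 𝔸)) = fun x => ((dbarAvgU (dbarIterU i (F x)) c : 𝔸ˣ) : 𝔸) := by
      funext x; rw [dbarIterU_succ]
    rw [hfun]
    have hmem : ∀ b : PBond P i, (blockOf b.src = c.src ∨ blockOf b.src = c.tgt) → (blockOf b.tgt = c.src ∨ blockOf b.tgt = c.tgt) →
        b.src ∈ S' ∧ b.tgt ∈ S' := by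
      intro b hbs hbt
      constructor
      · show blockOf b.src ∈ S
        rcases hbs with h | h <;> rw [h]
        exacts [hcs, hct]
      · show blockOf b.tgt ∈ S
        rcases hbt with h | h <;> rw [h]
        exacts [hcs, hct]
    -- the smallness `4ℓ·(2Lⁱs₀) < 1` of the loop and stair variables
    have h2x : 0 ≤ 2 * ((P.L : ℝ) ^ i * s₀) := by positivity
    have hlt : 4 * (((P.d + 2) * P.L : ℕ) : ℝ) * (2 * ((P.L : ℝ) ^ i * s₀)) < 1 := by
      rw [← hℓ]
      have hx0 : 0 ≤ (P.L : ℝ) ^ i * s₀ := by positivity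
      have hb' : 8 * 3800 * ℓ ^ 2 * ((P.L : ℝ) ^ i * s₀) ≤ 1 := by
        have : 8 * 3800 * ℓ ^ 2 * ((P.L : ℝ) ^ i * s₀) = 8 * 3800 * ℓ ^ 2 * (P.L : ℝ) ^ i * s₀ := by ring
        rw [this]; exact hbudget_i
      have hℓ2 : ℓ ≤ ℓ ^ 2 := by nlinarith
      nlinarith
    refine differentiableAt_coe_dbarAvgU_of_twoBlock (F := fun x => dbarIterU i (F x)) hi c
      (fun b hbs hbt => hF b (hmem b hbs hbt).1 (hmem b hbs hbt).2) ?_ ?_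
    · exact Prop8Chart.norm_loopHolU_sub_one_lt_one hi c h2x hlt fun b hbs hbt => hnear b (hmem b hbs hbt).1 (hmem b hbs hbt).2
    · intro y hy idx
      refine norm_stairHol_sub_one_lt_one hi y h2x hlt (fun b h1 h2 => hnear b ?_ ?_) idx
      · show blockOf b.src ∈ S
        rw [h1]; rcases hy with h | h <;> rw [h]
        exacts [hcs, hct]
      · show blockOf b.tgt ∈ S
        rw [h2]; rcases hy with h | h <;> rw [h]
        exacts [hcs, hct]

/-! ## §2 The block frames of the iterated double-bar average of a differentiable family -/

/-- ★ **THE BLOCK FRAME `x ↦ v(U̿^{(j)}(W_x))(z)` IS ℂ-DIFFERENTIABLE AT `x₀`** when the fine bond variables under the `(j+1)`-block `z` are differentiable at `x₀` and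
within `s` of `1` at `x₀`, `8·3800·ℓ²·L^{j+1}·s ≤ 1` (B3's `hWs`∕`hbudget` letters): the stair transporters of the near-flat double-bar field are within `1` of `1`, where
`eml` is analytic. [cite: Balaban1985Averaging, (110) p.34, Prop. 4 (134)-(135) p.38] -/
theorem differentiableAt_coe_vframeU_dbarIterU_family [NormOneClass 𝔸] (F : E → GaugeField P 0 𝔸ˣ) (x₀ : E) {j : ℕ} (hj : j + 1 ≤ P.m + P.K)
    (z : Site P (j + 1)) {s : ℝ} (hs0 : 0 ≤ s) (hbudget : 8 * 3800 * (((P.d + 2) * P.L : ℕ) : ℝ) ^ 2 * (P.L : ℝ) ^ (j + 1) * s ≤ 1)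
    (hflat : ∀ b : PBond P 0, iterBlockOf (j + 1) b.src = z → iterBlockOf (j + 1) b.tgt = z → ‖((F x₀ b : 𝔸ˣ) : 𝔸) - 1‖ ≤ s)
    (hdiff : ∀ b : PBond P 0, iterBlockOf (j + 1) b.src = z → iterBlockOf (j + 1) b.tgt = z → DifferentiableAt ℂ (fun x => ((F x b : 𝔸ˣ) : 𝔸)) x₀) :
    DifferentiableAt ℂ (fun x => ((vframeU (dbarIterU j (F x)) z : 𝔸ˣ) : 𝔸)) x₀ := by
  set ℓ : ℝ := (((P.d + 2) * P.L : ℕ) : ℝ) with hℓ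
  have hℓ1 : (1 : ℝ) ≤ ℓ := by
    rw [hℓ]; exact_mod_cast Nat.one_le_iff_ne_zero.mpr (Nat.mul_ne_zero (by omega) (by have := P.hL.2; omega))
  have hL1 : (1 : ℝ) ≤ P.L := by exact_mod_cast P.L_pos
  have hj' : j ≤ P.m + P.K := Nat.le_of_succ_le hj
  set S : Set (Site P j) := {y | blockOf y = z} with hS
  have hbudget_j : 8 * 3800 * ℓ ^ 2 * (P.L : ℝ) ^ j * s ≤ 1 := by
    refine le_trans ?_ hbudget
    have : (P.L : ℝ) ^ j ≤ (P.L : ℝ) ^ (j + 1) := pow_le_pow_right₀ hL1 (Nat.le_succ j)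
    have h0 : 0 ≤ 8 * 3800 * ℓ ^ 2 * s := by positivity
    nlinarith
  have hflat' : ∀ b : PBond P 0, iterBlockOf j b.src ∈ S → iterBlockOf j b.tgt ∈ S → ‖((F x₀ b : 𝔸ˣ) : 𝔸) - 1‖ ≤ s :=
    fun b hs ht => hflat b (by rw [iterBlockOf_succ]; exact hs) (by rw [iterBlockOf_succ]; exact ht)
  have hdiff' : ∀ b : PBond P 0, iterBlockOf j b.src ∈ S → iterBlockOf j b.tgt ∈ S → DifferentiableAt ℂ (fun x => ((F x b : 𝔸ˣ) : 𝔸)) x₀ :=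
    fun b hs ht => hdiff b (by rw [iterBlockOf_succ]; exact hs) (by rw [iterBlockOf_succ]; exact ht)
  -- the level-`j` double-bar field: differentiable and near-flat inside the block
  have hF : ∀ b : PBond P j, blockOf b.src = z → blockOf b.tgt = z → DifferentiableAt ℂ (fun x => ((dbarIterU j (F x) b : 𝔸ˣ) : 𝔸)) x₀ :=
    fun b hs ht => differentiableAt_coe_dbarIterU_family F x₀ j hj' S s hs0 hbudget_j hflat' hdiff' b hs ht
  have hnear : ∀ b : PBond P j, blockOf b.src = z → blockOf b.tgt = z → ‖((dbarIterU j (F x₀) b : 𝔸ˣ) : 𝔸) - 1‖ ≤ 2 * ((P.L : ℝ) ^ j * s) :=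
    fun b hs ht => norm_dbarIterU_sub_one_le_two_mul₀ hj' S (F x₀) hs0 hbudget_j hflat' b hs ht
  have h2x : 0 ≤ 2 * ((P.L : ℝ) ^ j * s) := by positivity
  have hlt : 4 * (((P.d + 2) * P.L : ℕ) : ℝ) * (2 * ((P.L : ℝ) ^ j * s)) < 1 := by
    rw [← hℓ]
    have hx0 : 0 ≤ (P.L : ℝ) ^ j * s := by positivity
    have hb' : 8 * 3800 * ℓ ^ 2 * ((P.L : ℝ) ^ j * s) ≤ 1 := by
      have : 8 * 3800 * ℓ ^ 2 * ((P.L : ℝ) ^ j * s) = 8 * 3800 * ℓ ^ 2 * (P.L : ℝ) ^ j * s := by ring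
      rw [this]; exact hbudget_j
    have hℓ2 : ℓ ≤ ℓ ^ 2 := by nlinarith
    nlinarith
  exact differentiableAt_coe_vframeU_of_block (F := fun x => dbarIterU j (F x)) hj z hF
    (norm_stairHol_sub_one_lt_one hj z h2x hlt fun b hs ht => hnear b hs ht)

/-! ## §3 The accumulated-frame quotient of an index-pinned differentiable family -/

section Quotient

variable (D : Domains P)

/-- ★★ **THE ACCUMULATED-FRAME QUOTIENT IS DIFFERENTIABLE IN THE PARAMETER, AT EVERY SITE OF EVERY LEVEL `j ≤ k`** — see the module docstring, §3.  `Vf` is ANY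
accumulated-frames function obeying the recursion (97); the family `W_x` is bondwise differentiable at `x₀`, its double-bar constraint data at the indices of `D` are those of
the fixed field `W′` for all `x` near `x₀`, and `W_{x₀}` is within `s_j` of `1` on the fine bonds under every block of `Ω_{j+1}`, `8·3800·ℓ²·L^{j+1}·s_j ≤ 1`.  Conclusion (a):
`x ↦ Vf W_x j y` is differentiable at `x₀` for `y ∈ Ω_j`; (b): `x ↦ Vf W_x j y · (Vf W′ j y)⁻¹` is differentiable at `x₀` for every `y`.
[cite: Balaban1985Averaging, (92) p.31, (97)-(100) p.32, (110) p.34; Balaban1984PropagatorsII, (2.3) p.224] -/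
theorem differentiableAt_coe_accFrames_quotient [NormOneClass 𝔸]
    (Vf : GaugeField P 0 𝔸ˣ → (j : ℕ) → Site P j → 𝔸ˣ) (hV0 : ∀ W x, Vf W 0 x = 1)
    (hVs : ∀ (W : GaugeField P 0 𝔸ˣ) (j : ℕ) (y : Site P (j + 1)), Vf W (j + 1) y = Vf W j (emb y) * vframeU (dbarIterU j W) y)
    (W' : GaugeField P 0 𝔸ˣ) (F : E → GaugeField P 0 𝔸ˣ) (x₀ : E)
    (hidx : ∀ᶠ x in 𝓝 x₀, ∀ idx : BondIdx D, dbarIterU (idx.1.1 : ℕ) (F x) idx.1.2 = dbarIterU (idx.1.1 : ℕ) W' idx.1.2)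
    (s : ℕ → ℝ) (hs0 : ∀ j, 0 ≤ s j) (hbudget : ∀ j, 8 * 3800 * (((P.d + 2) * P.L : ℕ) : ℝ) ^ 2 * (P.L : ℝ) ^ (j + 1) * s j ≤ 1)
    (hflat : ∀ (j : ℕ) (z : Site P (j + 1)), z ∈ D.Om (j + 1) → ∀ b : PBond P 0, iterBlockOf (j + 1) b.src = z → iterBlockOf (j + 1) b.tgt = z →
      ‖((F x₀ b : 𝔸ˣ) : 𝔸) - 1‖ ≤ s j)
    (hdiff : ∀ b : PBond P 0, DifferentiableAt ℂ (fun x => ((F x b : 𝔸ˣ) : 𝔸)) x₀) :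
    ∀ (j : ℕ), j ≤ D.k →
      (∀ y : Site P j, y ∈ D.Om j → DifferentiableAt ℂ (fun x => ((Vf (F x) j y : 𝔸ˣ) : 𝔸)) x₀) ∧
      ∀ y : Site P j, DifferentiableAt ℂ (fun x => ((Vf (F x) j y * (Vf W' j y)⁻¹ : 𝔸ˣ) : 𝔸)) x₀ := by
  -- levels of non-empty `Ω`'s are in the standing range; `Ω` is `emb`-closed
  have hlev : ∀ (j : ℕ) (z : Site P (j + 1)), z ∈ D.Om (j + 1) → j + 1 ≤ P.m + P.K := by
    intro j z hz
    have : j + 1 ≤ D.k := by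
      by_contra hlt
      rw [D.Om_eq_empty (by omega)] at hz
      exact absurd hz (Finset.notMem_empty _)
    exact this.trans D.hk
  have hemb : ∀ (j : ℕ) (z : Site P (j + 1)), z ∈ D.Om (j + 1) → emb z ∈ D.Om j := fun j z hz =>
    D.nested (emb z) (by rw [Site.blockOf_emb (hlev j z hz)]; exact hz)
  -- the `Ω`-block frames of the family are differentiable
  have hvf : ∀ (j : ℕ) (z : Site P (j + 1)), z ∈ D.Om (j + 1) → DifferentiableAt ℂ (fun x => ((vframeU (dbarIterU j (F x)) z : 𝔸ˣ) : 𝔸)) x₀ :=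
    fun j z hz => differentiableAt_coe_vframeU_dbarIterU_family F x₀ (hlev j z hz) z (hs0 j) (hbudget j) (hflat j z hz) fun b _ _ => hdiff b
  intro j
  induction j with
  | zero =>
    intro _
    refine ⟨fun y _ => ?_, fun y => ?_⟩
    · have h : (fun x => ((Vf (F x) 0 y : 𝔸ˣ) : 𝔸)) = fun _ => 1 := by
        funext x; rw [hV0, Units.val_one]
      rw [h]; exact differentiableAt_const _
    · have h : (fun x => ((Vf (F x) 0 y * (Vf W' 0 y)⁻¹ : 𝔸ˣ) : 𝔸)) = fun _ => 1 := by
        funext x; rw [hV0, hV0, inv_one, mul_one, Units.val_one]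
      rw [h]; exact differentiableAt_const _
  | succ j ih =>
    intro hj
    obtain ⟨ihΩ, ihq⟩ := ih (Nat.le_of_succ_le hj)
    -- (a) on `Ω_{j+1}`: a product of differentiable factors
    have hΩ : ∀ y : Site P (j + 1), y ∈ D.Om (j + 1) → DifferentiableAt ℂ (fun x => ((Vf (F x) (j + 1) y : 𝔸ˣ) : 𝔸)) x₀ := by
      intro y hy
      have h : (fun x => ((Vf (F x) (j + 1) y : 𝔸ˣ) : 𝔸)) = fun x => ((Vf (F x) j (emb y) : 𝔸ˣ) : 𝔸) * ((vframeU (dbarIterU j (F x)) y : 𝔸ˣ) : 𝔸) := by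
        funext x; rw [hVs, Units.val_mul]
      rw [h]
      exact (ihΩ (emb y) (hemb j y hy)).mul (hvf j y hy)
    refine ⟨hΩ, fun y => ?_⟩
    by_cases hy : y ∈ D.Om (j + 1)
    · -- (b) on `Ω_{j+1}`: `V_{j+1}(W_x) y · V_{j+1}(W′) y⁻¹ = V_j(W_x)(e)·v_x(y)·[v′(y)⁻¹·V_j(W′)(e)⁻¹]`, the bracket parameter-free
      have h : (fun x => ((Vf (F x) (j + 1) y * (Vf W' (j + 1) y)⁻¹ : 𝔸ˣ) : 𝔸)) = fun x =>
          ((Vf (F x) j (emb y) : 𝔸ˣ) : 𝔸) * ((vframeU (dbarIterU j (F x)) y : 𝔸ˣ) : 𝔸) * (((Vf W' (j + 1) y)⁻¹ : 𝔸ˣ) : 𝔸) := by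
        funext x; rw [hVs, Units.val_mul, Units.val_mul]
      rw [h]
      exact ((ihΩ (emb y) (hemb j y hy)).mul (hvf j y hy)).mul (differentiableAt_const _)
    · -- (b) off `Ω_{j+1}`: the two block frames coincide near `x₀`, so the quotient is the level-`j` quotient at `emb y` there
      have hev : (fun x => ((Vf (F x) (j + 1) y * (Vf W' (j + 1) y)⁻¹ : 𝔸ˣ) : 𝔸)) =ᶠ[𝓝 x₀]
          fun x => ((Vf (F x) j (emb y) * (Vf W' j (emb y))⁻¹ : 𝔸ˣ) : 𝔸) := by
        filter_upwards [hidx] with x hx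
        have hvv : vframeU (dbarIterU j (F x)) y = vframeU (dbarIterU j W') y := vframeU_dbarIterU_eq_of_not_mem_Om D hx hj y hy
        rw [hVs, hVs, hvv, mul_inv_rev, mul_assoc, mul_inv_cancel_left]
      exact hev.differentiableAt_iff.2 (ihq (emb y))

/-- ★ **B1's COARSE GAUGE IS DIFFERENTIABLE IN THE PARAMETER**: under the hypotheses of `differentiableAt_coe_accFrames_quotient`, for every parameter-free `c : T^{(k)} → 𝔸ˣ`
(the knit: the block-centre tower `(uS)_k` of the chart's gauge), `x ↦ Vf W_x k y · (Vf W′ k y)⁻¹ · c y` and its inverse are ℂ-differentiable at `x₀` at every top site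
`y` — the gauge `g` of ✓`emlIterU_top_eq_gaugeActT_frames` read along the family. [cite: Balaban1985Averaging, (11) p.19, (92) p.31, (97) p.32] -/
theorem differentiableAt_coe_gauge_frames [NormOneClass 𝔸]
    (Vf : GaugeField P 0 𝔸ˣ → (j : ℕ) → Site P j → 𝔸ˣ) (hV0 : ∀ W x, Vf W 0 x = 1)
    (hVs : ∀ (W : GaugeField P 0 𝔸ˣ) (j : ℕ) (y : Site P (j + 1)), Vf W (j + 1) y = Vf W j (emb y) * vframeU (dbarIterU j W) y)
    (W' : GaugeField P 0 𝔸ˣ) (F : E → GaugeField P 0 𝔸ˣ) (x₀ : E)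
    (hidx : ∀ᶠ x in 𝓝 x₀, ∀ idx : BondIdx D, dbarIterU (idx.1.1 : ℕ) (F x) idx.1.2 = dbarIterU (idx.1.1 : ℕ) W' idx.1.2)
    (s : ℕ → ℝ) (hs0 : ∀ j, 0 ≤ s j) (hbudget : ∀ j, 8 * 3800 * (((P.d + 2) * P.L : ℕ) : ℝ) ^ 2 * (P.L : ℝ) ^ (j + 1) * s j ≤ 1)
    (hflat : ∀ (j : ℕ) (z : Site P (j + 1)), z ∈ D.Om (j + 1) → ∀ b : PBond P 0, iterBlockOf (j + 1) b.src = z → iterBlockOf (j + 1) b.tgt = z →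
      ‖((F x₀ b : 𝔸ˣ) : 𝔸) - 1‖ ≤ s j)
    (hdiff : ∀ b : PBond P 0, DifferentiableAt ℂ (fun x => ((F x b : 𝔸ˣ) : 𝔸)) x₀) (c : Site P D.k → 𝔸ˣ) (y : Site P D.k) :
    DifferentiableAt ℂ (fun x => ((Vf (F x) D.k y * (Vf W' D.k y)⁻¹ * c y : 𝔸ˣ) : 𝔸)) x₀ ∧
      DifferentiableAt ℂ (fun x => (((Vf (F x) D.k y * (Vf W' D.k y)⁻¹ * c y)⁻¹ : 𝔸ˣ) : 𝔸)) x₀ := by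
  have hq := (differentiableAt_coe_accFrames_quotient D Vf hV0 hVs W' F x₀ hidx s hs0 hbudget hflat hdiff D.k le_rfl).2 y
  have h1 : DifferentiableAt ℂ (fun x => ((Vf (F x) D.k y * (Vf W' D.k y)⁻¹ * c y : 𝔸ˣ) : 𝔸)) x₀ := by
    have h : (fun x => ((Vf (F x) D.k y * (Vf W' D.k y)⁻¹ * c y : 𝔸ˣ) : 𝔸)) =
        fun x => ((Vf (F x) D.k y * (Vf W' D.k y)⁻¹ : 𝔸ˣ) : 𝔸) * ((c y : 𝔸ˣ) : 𝔸) := by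
      funext x; rw [Units.val_mul]
    rw [h]
    exact hq.mul (differentiableAt_const _)
  exact ⟨h1, differentiableAt_coe_inv h1⟩

end Quotient

end Summit.QuantumFields.YangMills.Theorems.HalvingCompetitorMapFramesSmooth

end
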